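import Summits.AtomisticToContinuum.FouriersLaw.Theorems.HoelderEscapeProfileAbelSpreadCeilingCanonicalTwin
import Summits.AtomisticToContinuum.FouriersLaw.Theorems.EmbeddedDrudeMourreMourreDissolutionGibbsMixing
import Literature.MathematicalPhysics.KineticTheory.InfiniteChainCorrelationContinuity
import Literature.MathematicalPhysics.KineticTheory.InfiniteChainEnergyDensityMoments
import Literature.MathematicalPhysics.KineticTheory.InfiniteChainShiftInvariantUniqueness
import Literature.MathematicalPhysics.KineticTheory.InfiniteChainCovarianceMixingBox
import Literature.MathematicalPhysics.KineticTheory.InfiniteChainGoodSetSymmetries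
import Literature.MathematicalPhysics.KineticTheory.InfiniteChainPartialMomentumReversal
import Literature.MathematicalPhysics.KineticTheory.TransportRegularityOfMixing
import Literature.MathematicalPhysics.KineticTheory.ZeroWavenumberSpace
import HarnessLib

/-!
# Stub `stub_fixedTimeRegularity` of line `regularity_collapse`, crux `HoelderEscapeProfile.AbelSpreadCeiling`
(item stmt-AtomisticToContinuum-16010; `--supports` file, closes nothing; line lead, 2026-08-17, cycle 1)

WHAT. Registered stub of the crux's skeleton (`Cruxes/AbelSpreadCeiling/Lines/regularity_collapse.lean`): the
FIXED-TIME regularities consumed by the dynamics-free Abel exchange lemma. For the pinned anharmonic chain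
`pinnedChain ω₂ lam β γ` (`ω₂, lam, β > 0`), the shift- and reversal-invariant DLR state `μ` at `T > 0` and ANY
`μ`-preserving dynamics `D`:
(c1) the static energy pulse `S(x,0) = Cov_μ(h_0, h_x)` has a finite second moment, `Σ_x (1+x²)|S(x,0)| < ∞`;
(c2) each current pair correlation `u ↦ G(x,u) = ∫ j_0 (j_x ∘ φ_u) dμ` is continuous;
(c3) `Σ_x |G(x,u)| < ∞` at every `u`.

HOW (everything is in the tree). (c3) is the corollary `hasAbsConvergentCorrelation_of_preservesMeasure` of the
canonical twin (sibling file `…CanonicalTwin`); (c2) is Vitali along orbits,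
`InfiniteChainDynamics.continuous_integral_bondCurrentZ_mul_flow_pinnedChain`, the state being superstable
(`hasSuperstabilityEstimate_of_isShiftInvariant_pinnedChain`); (c1): uniqueness of the shift-invariant DLR state
(`eq_of_isChainGibbsMeasure_of_isShiftInvariant_pinnedChain`) identifies `μ` with the exponentially ρ-mixing
transfer-operator state of `MourreDissolution.exists_gibbsState_mixing_pinnedChain`; the box form of mixing
(`abs_covariance_comp_chainShift_le_of_mixing`) applied to the local observable `h_0` (sites `-1, 0, 1`, in `L²` by
`memLp_energyDensityZ_pinnedChain`) gives `|Cov_μ(h_0, h_0 ∘ τ_x)| ≤ K e^{-m(|x|-2)₊}`, and `Σ_x (1+x²) e^{-m|x|} < ∞`;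
finally `h_0 ∘ τ_x = h_x` (`energyDensityZ_comp_chainShift`), `∫ h_x = ∫ h_0` (translation invariance) and
`φ_0 = id` a.e. identify the covariance with `S(x,0)`.
-/

noncomputable section

namespace Summit.AtomisticToContinuum.FouriersLaw.Theorems.AbelSpreadCeiling.RegularityCollapse

open MeasureTheory ProbabilityTheory Filter Set Function
open scoped Topology BigOperators
open Literature.MathematicalPhysics.KineticTheory.HeatConduction

/-- **Polynomially weighted geometric series over `ℤ`**: `Σ_x (1 + x²) r^{|x|} < ∞` for `0 ≤ r < 1`. [folklore] -/
theorem summable_one_add_sq_mul_pow_natAbs {r : ℝ} (hr0 : 0 ≤ r) (hr1 : r < 1) :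
    Summable fun x : ℤ => (1 + (x : ℝ) ^ 2) * r ^ x.natAbs := by
  have hn : ‖r‖ < 1 := by rw [Real.norm_of_nonneg hr0]; exact hr1
  have h1 : Summable fun n : ℕ => (1 + (n : ℝ) ^ 2) * r ^ n := by
    have hg := summable_geometric_of_lt_one hr0 hr1
    have hp := summable_pow_mul_geometric_of_norm_lt_one 2 hn
    have e : (fun n : ℕ => (1 + (n : ℝ) ^ 2) * r ^ n) = fun n : ℕ => r ^ n + (n : ℝ) ^ 2 * r ^ n := by
      funext n; ring
    rw [e]; exact hg.add hp
  refine (summable_int_comp_natAbs h1).congr fun x => ?_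
  simp only [Nat.cast_natAbs, Int.cast_abs, sq_abs]

/-- **Second spatial moment of the static autocovariances of a local observable under exponential
ρ-mixing.** If the probability measure `μ` is exponentially ρ-mixing between half-lines (`hmix`, rate `m > 0`)
and translation invariant, then for a measurable square-integrable `a` depending on the sites of `[-R, R]`,
`Σ_x (1 + x²) |Cov_μ(a, a ∘ τ_x)| < ∞` (box form of mixing: `|Cov_μ(a, a ∘ τ_x)| ≤ K e^{-m(|x|-2R)₊}`).
[folklore] -/
theorem summable_one_add_sq_mul_abs_covariance_of_mixing {μ : Measure ChainConfig} [IsProbabilityMeasure μ]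
    {C m : ℝ}
    (hmix : ∀ (p : ℤ) (n : ℕ) (f g : ChainConfig → ℝ),
      DependsOn f {i : ℤ | i ≤ p} → DependsOn g {i : ℤ | p + n ≤ i} →
      Measurable f → Measurable g → MemLp f 2 μ → MemLp g 2 μ →
      |MeasureTheory.integral μ (fun σ => f σ * g σ) -
          MeasureTheory.integral μ f * MeasureTheory.integral μ g| ≤
        C * Real.exp (-(m * n)) * (MeasureTheory.integral μ (fun σ => f σ ^ 2)) ^ (1 / 2 : ℝ) *
          (MeasureTheory.integral μ (fun σ => g σ ^ 2)) ^ (1 / 2 : ℝ))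
    (hm : 0 < m) (hτ : ∀ x : ℤ, MeasurePreserving (chainShift x) μ μ)
    {a : ChainConfig → ℝ} {R : ℕ}
    (ha : DependsOn a (Set.Icc (-(R : ℤ)) R)) (ham : Measurable a) (ha2 : MemLp a 2 μ) :
    Summable fun x : ℤ => (1 + (x : ℝ) ^ 2) * |cov[a, a ∘ chainShift x; μ]| := by
  set A := Real.sqrt (∫ σ, a σ ^ 2 ∂μ) with hA
  have hA0 : 0 ≤ A := Real.sqrt_nonneg _
  set r : ℝ := Real.exp (-m) with hr
  have hr0 : 0 ≤ r := (Real.exp_pos _).le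
  have hr1 : r < 1 := Real.exp_lt_one_iff.2 (neg_lt_zero.2 hm)
  have hC0 : 0 ≤ max C 1 := zero_le_one.trans (le_max_right _ _)
  set K : ℝ := max C 1 * Real.exp (m * (2 * R)) * A * A with hK
  have hsum : Summable fun x : ℤ => K * ((1 + (x : ℝ) ^ 2) * r ^ x.natAbs) :=
    (summable_one_add_sq_mul_pow_natAbs hr0 hr1).mul_left K
  refine Summable.of_nonneg_of_le (fun x => mul_nonneg (by positivity) (abs_nonneg _)) (fun x => ?_) hsum
  have hb := abs_covariance_comp_chainShift_le_of_mixing hmix hτ ha ham ha2 ha ham ha2 x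
  -- the gap `(|x| - 2R)₊` is at least `|x| - 2R`
  have hk : (x.natAbs : ℝ) - 2 * R ≤ (((|x| - R - R).toNat : ℕ) : ℝ) := by
    have h1 : ((|x| - R - R : ℤ) : ℝ) ≤ (((|x| - R - R).toNat : ℕ) : ℝ) := by
      exact_mod_cast Int.self_le_toNat _
    have h2 : ((|x| - R - R : ℤ) : ℝ) = (x.natAbs : ℝ) - 2 * R := by
      rw [Nat.cast_natAbs]; push_cast; ring
    linarith
  have hexp : Real.exp (-(m * (((|x| - R - R).toNat : ℕ) : ℝ))) ≤ Real.exp (m * (2 * R)) * r ^ x.natAbs := by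
    rw [hr, ← Real.exp_nat_mul, ← Real.exp_add]
    have := mul_le_mul_of_nonneg_left hk hm.le
    exact Real.exp_le_exp.2 (by nlinarith)
  calc (1 + (x : ℝ) ^ 2) * |cov[a, a ∘ chainShift x; μ]|
      ≤ (1 + (x : ℝ) ^ 2) * (max C 1 * Real.exp (-(m * (((|x| - R - R).toNat : ℕ) : ℝ))) * A * A) := by
        gcongr
    _ ≤ (1 + (x : ℝ) ^ 2) * (max C 1 * (Real.exp (m * (2 * R)) * r ^ x.natAbs) * A * A) := by
        gcongr
    _ = K * ((1 + (x : ℝ) ^ 2) * r ^ x.natAbs) := by rw [hK]; ring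

/-- **(c1) for the pinned anharmonic chain: finite second spatial moment of the static energy pulse.** For
`pinnedChain ω₂ lam β γ` (`ω₂, lam, β > 0`), the shift-invariant DLR state `μ` at `T > 0`, any `μ`-preserving
dynamics `D` and the split-bond site energy `h = energyDensityZ`:
`Σ_x (1+x²) |∫ (h_0 - ⟨h_0⟩)(h_x ∘ φ_0 - ⟨h_0⟩) dμ| < ∞` (uniqueness of the shift-invariant DLR state +
exponential ρ-mixing of the transfer-operator state + locality of `h_0`). [folklore] -/
theorem summable_one_add_sq_mul_abs_staticPulse {ω₂ lam β γ : ℝ} (hω : 0 < ω₂) (hl : 0 < lam)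
    (hβ : 0 < β) {T : ℝ} (hT : 0 < T) {μ : Measure ChainConfig}
    (hG : (pinnedChain ω₂ lam β γ).IsChainGibbsMeasure T μ) (hSI : IsShiftInvariant μ)
    (D : InfiniteChainDynamics (pinnedChain ω₂ lam β γ)) (hP : D.PreservesMeasure μ)
    {h : ChainConfig → ℤ → ℝ} (hh : h = fun σ x => (pinnedChain ω₂ lam β γ).energyDensityZ σ x) :
    Summable fun x : ℤ => (1 + (x : ℝ) ^ 2) *
      |∫ σ, (h σ 0 - ∫ σ', h σ' 0 ∂μ) * (h (D.flow 0 σ) x - ∫ σ', h σ' 0 ∂μ) ∂μ| := by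
  subst hh
  -- (M): the given shift-invariant DLR state IS the mixing transfer-operator state (uniqueness)
  obtain ⟨μ', hG', hS', hss', -, C, m, hm, hmix⟩ :=
    Summit.AtomisticToContinuum.FouriersLaw.Theorems.MourreDissolution.exists_gibbsState_mixing_pinnedChain
      ω₂ lam β γ hω hl.le hβ.le T hT
  have hμμ' : μ = μ' :=
    OscillatorChain.eq_of_isChainGibbsMeasure_of_isShiftInvariant_pinnedChain γ hω hl.le hβ.le hT hG hSI hG' hS'
  subst hμμ'
  have hss : (pinnedChain ω₂ lam β γ).HasSuperstabilityEstimate μ := hss'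
  haveI : IsProbabilityMeasure μ := hss.1
  have hτ : ∀ x : ℤ, MeasurePreserving (chainShift x) μ μ := hSI.measurePreserving_chainShift
  -- the local observable `h_0`: measurable, depends on `[-1, 1]`, square integrable
  have hUm : Measurable (pinnedChain ω₂ lam β γ).U := OscillatorChain.measurable_pinnedChain_U ω₂ lam β γ
  have hVm : Measurable (pinnedChain ω₂ lam β γ).V := OscillatorChain.measurable_pinnedChain_V ω₂ lam β γ
  have ham : Measurable fun σ => (pinnedChain ω₂ lam β γ).energyDensityZ σ 0 :=
    OscillatorChain.measurable_energyDensityZ _ hUm hVm 0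
  have had : DependsOn (fun σ => (pinnedChain ω₂ lam β γ).energyDensityZ σ 0)
      (Set.Icc (-((1 : ℕ) : ℤ)) ((1 : ℕ) : ℤ)) := by
    rw [Nat.cast_one]
    exact OscillatorChain.dependsOn_energyDensityZ_zero _
  have ha2 : MemLp (fun σ => (pinnedChain ω₂ lam β γ).energyDensityZ σ 0) 2 μ :=
    OscillatorChain.memLp_energyDensityZ_pinnedChain γ hω.le hl.le hβ.le hss 0 (by norm_num)
  have hsum := summable_one_add_sq_mul_abs_covariance_of_mixing hmix hm hτ had ham ha2
  refine hsum.congr fun x => ?_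
  congr 2
  -- `Cov_μ(h_0, h_0 ∘ τ_x) = ∫ (h_0 - ⟨h_0⟩)(h_x ∘ φ_0 - ⟨h_0⟩) dμ`
  have hmean : ∫ σ, (pinnedChain ω₂ lam β γ).energyDensityZ (chainShift x σ) 0 ∂μ =
      ∫ σ, (pinnedChain ω₂ lam β γ).energyDensityZ σ 0 ∂μ :=
    integral_comp_chainShift (hτ x) (F := fun σ => (pinnedChain ω₂ lam β γ).energyDensityZ σ 0)
      ham.aestronglyMeasurable
  simp only [covariance, comp_apply]
  rw [hmean]
  refine integral_congr_ae ?_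
  filter_upwards [D.flow_zero_ae_eq hP] with σ hσ
  rw [hσ, OscillatorChain.energyDensityZ_chainShift, zero_add]

/-- **Stub `stub_fixedTimeRegularity` (registered signature, verbatim).** Fixed-time regularities of the
Green–Kubo objects of the pinned anharmonic chain in its shift- and reversal-invariant DLR state at `T > 0`, for ANY
`μ`-preserving dynamics: (c1) `Σ_x (1+x²)|S(x,0)| < ∞` for the static energy pulse, (c2) continuity of every current
pair correlation `u ↦ G(x,u)`, (c3) `Σ_x |G(x,u)| < ∞` at every `u`. [cite: Georgii2011, Thm 10.25 and §11.1] -/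
theorem stub_fixedTimeRegularity :
    ∀ ω₂ lam β γ : ℝ, 0 < ω₂ → 0 < lam → 0 < β → ∀ T : ℝ, 0 < T → ∀ μ : MeasureTheory.Measure ChainConfig, (pinnedChain ω₂ lam β γ).IsChainGibbsMeasure T μ → IsShiftInvariant μ → μ.map (fun σ : ChainConfig => fun x : ℤ => ((σ x).1, -(σ x).2)) = μ → ∀ D : InfiniteChainDynamics (pinnedChain ω₂ lam β γ), D.PreservesMeasure μ → (∀ t : ℝ, ∀ᵐ σ ∂μ, D.flow t (shift σ) = shift (D.flow t σ)) → ∀ h : ChainConfig → ℤ → ℝ, h = (fun (σ : ChainConfig) (x : ℤ) => (σ x).2 ^ 2 / 2 + (pinnedChain ω₂ lam β γ).U (σ x).1 + ((pinnedChain ω₂ lam β γ).V ((σ (x + 1)).1 - (σ x).1) + (pinnedChain ω₂ lam β γ).V ((σ x).1 - (σ (x - 1)).1)) / 2) → ∀ S : ℤ → ℝ → ℝ, S = (fun (x : ℤ) (t : ℝ) => ∫ σ, (h σ 0 - ∫ σ', h σ' 0 ∂μ) * (h (D.flow t σ) x - ∫ σ', h σ' 0 ∂μ) ∂μ) → ∀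 G : ℤ → ℝ → ℝ, G = (fun (x : ℤ) (t : ℝ) => ∫ σ, (pinnedChain ω₂ lam β γ).bondCurrentZ σ 0 * (pinnedChain ω₂ lam β γ).bondCurrentZ (D.flow t σ) x ∂μ) → Summable (fun x : ℤ => (1 + (x : ℝ) ^ 2) * |S x 0|) ∧ (∀ x : ℤ, Continuous (fun t : ℝ => G x t)) ∧ (∀ t : ℝ, Summable (fun x : ℤ => |G x t|)) := by
  intro ω₂ lam β γ hω hl hβ T hT μ hG hSI hR D hP _hcomm h hh S hS G hGdef
  subst hS hGdef
  -- the shift-invariant DLR state is superstable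
  have hss : (pinnedChain ω₂ lam β γ).HasSuperstabilityEstimate μ :=
    OscillatorChain.hasSuperstabilityEstimate_of_isShiftInvariant_pinnedChain γ hω hl.le hβ.le hT hG hSI
  -- the crux's split-bond site energy is `energyDensityZ`, definitionally
  have hh' : h = fun σ x => (pinnedChain ω₂ lam β γ).energyDensityZ σ x := hh
  refine ⟨?_, fun x => ?_, fun t => ?_⟩
  · -- (c1)
    exact summable_one_add_sq_mul_abs_staticPulse hω hl hβ hT hG hSI D hP hh'
  · -- (c2)
    exact InfiniteChainDynamics.continuous_integral_bondCurrentZ_mul_flow_pinnedChain γ hω.le hl.le hβ hss D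
      hP x 0
  · -- (c3)
    exact (hasAbsConvergentCorrelation_of_preservesMeasure hω hl hβ hT hG hSI hR D hP t).2

end Summit.AtomisticToContinuum.FouriersLaw.Theorems.AbelSpreadCeiling.RegularityCollapse

end
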